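import Summits.BirchSwinnertonDyer.BirchSwinnertonDyer.Theorems.EisensteinPrimesMazurMCOnCellBTwistbackDisplays22
import Summits.BirchSwinnertonDyer.BirchSwinnertonDyer.Theorems.EisensteinPrimesA10IsogenyCertificates08
import Summits.BirchSwinnertonDyer.BirchSwinnertonDyer.Theorems.EisensteinPrimesMazurMCOnCellBTwistbackConnectedPartnerZigzag
import Summits.BirchSwinnertonDyer.BirchSwinnertonDyer.Theorems.EisensteinPrimesMazurMCOnCellBTwistbackIsogenyTransport
import Summits.BirchSwinnertonDyer.BirchSwinnertonDyer.Theorems.SchneiderFreeAdditiveX3PoitouTateSelmerDualityHolds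
import Summits.BirchSwinnertonDyer.BirchSwinnertonDyer.Theorems.SchneiderFreeAdditiveX3PoitouTateShaDualityHolds
import Literature.NumberTheory.EllipticCurves.HeegnerFieldOfDiscriminantProofs
import Literature.NumberTheory.EllipticCurves.IsogenyIdProofs
import HarnessLib

/-!
# Crux 3 `MazurMCOnCellB` (stmt-BirchSwinnertonDyer-19033), line `twistback` v12 (LEAD g15, registered 2026-08-29T00:04:52Z,
# sha256 540948e0…) — ROAD (b) CLASS PACKAGING of the A10 class `384450d` at `p = 3`: the ONE sub-population-(ii) class
# (NON-split at `3`, `c(E) ≠ 1`) with no road-(e) unit end inside lam-a's boxes (R3/R4b, `nmax ≤ 3·10⁸`) but WITH an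
# ORDER-ONE ANCHOR (lam-a g16's display `…TwistbackDisplays22.Cell384450d1`, p673909: `K = ℚ(√−359)`, `ord_{T=0} ϖL₃(Wd) = 1`
# read at ONE minimal model `Wd` of `384450d1 ⊗ χ_{−359}`): the anchor certificate at ONE model is upgraded to EVERY minimal
# model (§1, generic), so both Cremona members carry the v11/v12 «connected non-split ORDER-ONE ANCHOR» datum and the
# registered stub 6⁷'s RIGHT disjunct («connected partnered vertex») VERBATIM, and Mazur's main conjecture + `BSD(E,3)` hold at
# both members modulo the cone's named facts + THREE readings (`hr`, `hN`, `hordL`) — closing sub-population (ii) (14/14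
# classes) in the kernel modulo readings

Width seat `bsd-line-x2-p1-w8` (gen 5), cell `bsd-eis`, 2026-08-29; lane (B) «per-cell wrappers for anchored non-split cells»
(LEAD g15, STATUS 23:24:25Z), the road-(b) analogue of this seat's road-(e) class packagings `…TwistbackReachableCell<class>`
(74 files, p677124 … p682885); `--supports stmt-BirchSwinnertonDyer-19033 --as helper`. THEOREMS ONLY: no `def`, no named fact
introduced, no `sorry`. Not retyped, imported: lam-a's display (`cellB_384450d1_of_analyticRank`, `satisfiesHeegnerHypothesis_N`,
`exists_variableChange_twist`, the minimal model `Wd`), ky's `RouteGSplitDisplay384450d1RankLocal.nonsplit_384450d1`, x2-p1-w7 g3's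
kernel certificate `isIsogenous_384450d1_384450d2` (`…A10IsogenyCertificates08`), LEAD g15's doors p675388
(`…OrderOneAnchorZigzag` §2: `BSD_p` / Mazur MC from the anchor datum), p678299 §1 (the transport pattern reused in §1 here),
p679233 §2 (`connectedPartner_of_connectedOrderOneAnchor`: anchor datum ⟹ 6⁷'s right disjunct), x2-p1-w7 g3's `…IsogenyTransport`.

WHAT. `384450d1 = [1, 1, 0, −292284525, 12563872228125]` (`N = 2·3·5²·11·233`, non-split at `3`, rational `3`-line;
READINGS `hr` : `r_an = 0`, `hN` : `N = 384450` — Cremona); `384450d2 = [1, 1, 0, 2620799475, −332237331799875]` (`3`-isogenous).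
ANCHOR: `K = ℚ(√−359)` (`−359 ≡ 1 (mod 8)`, `(−359/3) = (−359/5) = (−359/11) = (−359/233) = 1`), partner
`Wd = 384450d1 ⊗ χ_{−359} = [1, 1, 0, −37669921933650, −581314396059525847500]` (minimal, `⟨1,150,½,0⟩⁻¹ • Wd = W.quadraticTwist (−359)`;
READING `hordL`: `ord_{T=0} ϖL₃(Wd) = 1` for the non-split Mazur–Tate–Teitelbaum function — lam-a ENGINE T `(0,3)@5`,
`v₃(L′(0)) = 1`; `L′(Wd,1) = 5.5025898017…`, PARI j311785).

* §0 `isElliptic_384450d2`, `isGloballyMinimal_384450d2` (`Δ = −2⁵·3⁹·5⁹·11¹²·233³`; support-form Kraus–Silverman, `11⁴ ∤ c₄`).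
* §1 `orderOne_forall_minimal_models_of_one` — GENERIC (any `p`, any `W₀`, any `d`): the order-one certificate
  «`∀` newform `f` of `Wd`, `∀ ϖ` with `ϖ·Ω(Wd) = Ω⁺(f)`, `∀` non-split `p`-adic `L` of `f`: `ord_{T=0} L = 1`» read at ONE
  globally minimal model `Wd₀` of `W₀^{(d)}` holds at EVERY globally minimal model `Wd` (two minimal models are `ℚ`-isomorphic,
  hence isogenous: same newform by `IsNewformOf.of_isIsogenous`, `Ω(Wd) = q·Ω(Wd₀)` with `q ∈ ℚ_{>0}` by
  `KatoFreeSandwich.exists_rat_pos_realPeriodRat_eq_mul_of_isIsogenous`, so `ϖq` feeds the certificate at `Wd₀`; = p678299 §1's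
  transport with `W₀' = W₀`). Fact-free. This is what lets a single-model display reading enter the `∀`-models slot of the stubs.
* §2 `connectedOrderOneAnchor_of_isIsogenous_384450d1` — the v11 datum / `hA` of p675388 §2 VERBATIM at `p = 3`, at EVERY
  globally minimal `W' ∼ 384450d1`, with `K = sqrtField (−359)` INSTANTIATED (`W₁ = W₀ = 384450d1`, empty zig-zag); readings
  `hN`, `hordL`; fact-free. `connectedPartner_of_isIsogenous_384450d1` — the REGISTERED stub 6⁷'s RIGHT disjunct VERBATIM at
  every such `W'` (p679233 §2; PUB: `PublishedInputs`, Disegni Thm. 4(1), Disegni Thm. 2.4; + reading `hr`);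
  `connectedPartner_384450d_members` — at both Cremona members (disjunction binder, kernel certificate).
* §3 `mazurMainConjectureAt_of_isIsogenous_384450d1`, `bsdp_of_isIsogenous_384450d1`, `…_384450d_members_at_three` ×2 — Mazur MC
  and `BSD(E,3)` at every minimal member from the v12 cone BY NAME (`PublishedInputs` item 19037; Disegni 2020 Thm. 4(1) and
  Thm. 2.4, Mazur 1978 Cor. 4.1, Hsieh 2014, LZZ 2018 — PUBLISHED; Keller–Yin Thm. D — PREPRINT; Poitou–Tate ×2 tree theorems)
  + the three readings, through p675388 §2 and x2-p1-w7 g3's `…IsogenyTransport`.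

HONEST FRAMING: CONDITIONAL theorems — on the named facts exactly as labelled (Keller–Yin Thm. D is an UNREFEREED PREPRINT,
arXiv:2402.12781v2 Thm. 5.1.3, flag `KYD-gap`) and on the readings `hr`, `hN`, `hordL` (lam-a g16's instruments, seat memo
MEMO-16; NOT certified in the kernel). lam-a's own display p673909 reaches Mazur MC at `384450d1` through the older door
p640749 §4 with the Heegner datum (`Dt`, `H`, `ι`, `P`) and STEP L (`hlow`) as HYPOTHESES; here those are discharged BY NAME
inside p675388 (Keller–Yin Thm. D for STEP L), so the hypotheses left are the cone + three readings. Nothing is booked, no cell /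
label / tier moves; no registered stub is closed (6⁷ is implied on this class by its right disjunct, modulo readings); no summit
statement, no Mazur main conjecture and no case of BSD is proved unconditionally for any curve.

References: [KellerYin2024] Thm. D (PRE); [Disegni2020] Thm. 2.4, Thm. 4(1); [Wuthrich2014] Thm. 16; [LiuZhangZhang2018]
Thms. 1.5.1/1.5.3; [Hsieh2014] Thm. 1; [Mazur1978] Cor. 4.1; [PerrinRiou1987] Cor. 1.8; [MilneADT2006] I Thm. 7.3; [Knapp1993]
Thm. 11.67; [GrossLMS1991] §1; [Marcus2018] Ch. 2 Thm. 1; [SilvermanAEC2009] III.4, VII.1 Rem. 1.1, §C.16; [Kraus1989] Prop. 1–2;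
[Velu1971]; [CremonaAlgorithms1997] §3.8, Table 1 (class 384450d).
-/

set_option autoImplicit false

-- `Summit.BirchSwinnertonDyer.BirchSwinnertonDyer.…`: the summit and its single sub-problem share a name.
set_option linter.dupNamespace false

noncomputable section

open scoped Classical MatrixGroups ModularForm

open CongruenceSubgroup WeierstrassCurve NumberField IsDedekindDomain
  Literature.NumberTheory.EllipticCurves
  Literature.NumberTheory.GaloisRepresentations
  Literature.NumberTheory.EllipticCurves.ModularForms
  Literature.NumberTheory.QuadraticFields
  Literature.NumberTheory.EllipticCurves.Rank1Residual
  Literature.NumberTheory.EllipticCurves.Rank1Residual.Typed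
  Literature.NumberTheory.EllipticCurves.Wuthrich2014
  Literature.NumberTheory.EllipticCurves.Disegni2020
  Literature.NumberTheory.EllipticCurves.GreenbergVatsal2000
  Literature.NumberTheory.EllipticCurves.KellerYin2024
  Literature.NumberTheory.EllipticCurves.TateCurve
  Literature.NumberTheory.GaloisCohomology
  Summit.BirchSwinnertonDyer.Rank1Residual
  Summit.BirchSwinnertonDyer.Rank1Residual.X11b
  Summit.BirchSwinnertonDyer.Rank1Residual.X1
  Summit.BirchSwinnertonDyer.Rank1Residual.X2
  Summit.BirchSwinnertonDyer.Rank1Residual.X2.RouteGSplitDisplay384450d1RankLocal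
  Summit.BirchSwinnertonDyer.BirchSwinnertonDyer.Theses
  Summit.BirchSwinnertonDyer.BirchSwinnertonDyer.Theorems
  Summit.BirchSwinnertonDyer.BirchSwinnertonDyer.Theorems.EisensteinPrimesMazurMCOnCellBTwistbackTwoStepDefs
  Summit.BirchSwinnertonDyer.BirchSwinnertonDyer.Theorems.EisensteinPrimesMazurMCOnCellBTwistbackDisplays22.Cell384450d1
  Summit.BirchSwinnertonDyer.BirchSwinnertonDyer.Theorems.EisensteinPrimesA10IsogenyCertificates08

namespace Summit.BirchSwinnertonDyer.BirchSwinnertonDyer.Theorems.EisensteinPrimesMazurMCOnCellBTwistbackAnchoredCell384450d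

/-! ## §0 The second Cremona member `384450d2 = [1, 1, 0, 2620799475, −332237331799875]` -/

/-- `384450d2 = [1, 1, 0, 2620799475, −332237331799875]` is elliptic (`Δ = −2⁵·3⁹·5⁹·11¹²·233³ ≠ 0`).
[cite: CremonaAlgorithms1997, Table 1 (class 384450d)] -/
theorem isElliptic_384450d2 : (⟨1, 1, 0, 2620799475, -332237331799875⟩ : WeierstrassCurve ℚ).IsElliptic :=
  isElliptic_of_discOf_ne_zero 1 1 0 2620799475 (-332237331799875) (by decide +kernel)

set_option maxRecDepth 100000 in
/-- `384450d2` is globally minimal (support-form Kraus–Silverman criterion at `2`, `3`, `5`, `11`, `233`; list entries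
`(q, v_q N, v_q Δ)`; at `11`: `11¹² ∣ Δ` but `11⁴ ∤ c₄`). [cite: SilvermanAEC2009, VII.1 Remark 1.1] [cite: Kraus1989, Prop. 1 and Prop. 2] -/
theorem isGloballyMinimal_384450d2 : (⟨1, 1, 0, 2620799475, -332237331799875⟩ : WeierstrassCurve ℚ).IsGloballyMinimal :=
  X11b.isGloballyMinimal_of_krausCriterion_support 1 1 0 2620799475 (-332237331799875)
    [(2, 1, 5), (3, 1, 9), (5, 2, 9), (11, 1, 12), (233, 1, 3)] (by intro t ht; fin_cases ht <;> norm_num)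
    (by decide +kernel) (by decide +kernel)

/-! ## §1 GENERIC: the order-one certificate at ONE minimal model of the twist gives it at EVERY minimal model -/

/-- **One minimal model suffices for the order-one anchor certificate** (generic: any prime `p`, any `W₀`, any `d`).
If `Wd₀` is a globally minimal model of `W₀^{(d)}` (`C₀ • Wd₀ = W₀.quadraticTwist d`) at which «for every newform `f` of
`Wd₀`, every `ϖ` with `ϖ·Ω(Wd₀) = Ω⁺(f)` and every non-split multiplicative `p`-adic `L`-function `L` of `f`,
`ord_{T=0} L = 1`» holds, then the same holds at EVERY globally minimal model `Wd` of `W₀^{(d)}`: `Wd₀ ∼ Wd` through the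
twist (`isIsogenous_of_smul_eq`, `isIsogenous_of_smul_eq'`), so a newform of `Wd` is a newform of `Wd₀`
(`IsNewformOf.of_isIsogenous`) and `Ω(Wd) = q·Ω(Wd₀)` with `q ∈ ℚ_{>0}`
(`KatoFreeSandwich.exists_rat_pos_realPeriodRat_eq_mul_of_isIsogenous`), whence `(ϖq)·Ω(Wd₀) = Ω⁺(f)` and the certificate
at `Wd₀` applies — LEAD g15's p678299 §1 transport with `W₀' = W₀`. Fact-free. This is the bridge from a display's
single-model reading `hordL` to the `∀`-models slot of p675388 / the registered stubs 6⁶–6⁷.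
[cite: Knapp1993, Thm. 11.67 (PDF p. 281)] [cite: SilvermanAEC2009, §C.16] -/
theorem orderOne_forall_minimal_models_of_one {p : ℕ} [Fact p.Prime] (W₀ : WeierstrassCurve ℚ) [W₀.IsElliptic]
    {d : ℚ} (Wd₀ : WeierstrassCurve ℚ) [Wd₀.IsElliptic] [Wd₀.IsGloballyMinimal]
    (hC₀ : ∃ C : VariableChange ℚ, C • Wd₀ = W₀.quadraticTwist d)
    (h : ∀ {M : ℕ} [NeZero M] (f : CuspForm (Gamma0 M) 2), IsNewformOf Wd₀ f →
      ∀ (ϖ : ℚ), (ϖ : ℝ) * Wd₀.realPeriodRat = plusPeriod f →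
      ∀ L : PowerSeries ℚ_[p], IsMultPAdicLFunctionOf f p (-1) L → L.order = ((1 : ℕ) : ℕ∞)) :
    ∀ (Wd : WeierstrassCurve ℚ) [Wd.IsElliptic] [Wd.IsGloballyMinimal],
      (∃ C : VariableChange ℚ, C • Wd = W₀.quadraticTwist d) →
      ∀ {M : ℕ} [NeZero M] (f : CuspForm (Gamma0 M) 2), IsNewformOf Wd f →
      ∀ (ϖ : ℚ), (ϖ : ℝ) * Wd.realPeriodRat = plusPeriod f →
      ∀ L : PowerSeries ℚ_[p], IsMultPAdicLFunctionOf f p (-1) L → L.order = ((1 : ℕ) : ℕ∞) := by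
  intro Wd _ _ hWd M _ f hf ϖ hϖ L hL
  obtain ⟨C, hC⟩ := hWd
  obtain ⟨C₀, hC₀'⟩ := hC₀
  -- the two minimal models are isogenous through the twist
  have hiso : IsIsogenous Wd₀ Wd := (isIsogenous_of_smul_eq hC₀').trans' (isIsogenous_of_smul_eq' hC)
  -- same newform, rational positive period ratio
  have hf₀ : IsNewformOf Wd₀ f := hf.of_isIsogenous hiso
  obtain ⟨q, -, hq⟩ := KatoFreeSandwich.exists_rat_pos_realPeriodRat_eq_mul_of_isIsogenous hiso
  have hϖ₀ : ((ϖ * q : ℚ) : ℝ) * Wd₀.realPeriodRat = plusPeriod f := by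
    rw [← hϖ, hq]; push_cast; ring
  exact h f hf₀ (ϖ * q) hϖ₀ L hL

/-! ## §2 The ORDER-ONE ANCHOR datum and the registered stub 6⁷'s RIGHT disjunct along the class `384450d` -/

/-- **The v11/v12 «connected non-split ORDER-ONE ANCHOR» datum (VERBATIM `hA` of p675388 §2) at `p = 3`, at EVERY globally
minimal `W' ∼ 384450d1`, with `K = ℚ(√−359)` INSTANTIATED** (`sqrtField (−359)`, `d_K = −359`): `W₁ = W₀ = 384450d1` through the
isogeny, the EMPTY zig-zag, `3` non-split for `384450d1` (`nonsplit_384450d1`), Heegner for `N = 384450` by lam-a's Kronecker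
lemma `satisfiesHeegnerHypothesis_N` moved to `conductorNorm` by the reading `hN`, Heegner for `3`, `d_K` odd `< −4`, and the
order-one certificate at EVERY minimal model of the twist from the single-model reading `hordL` at lam-a's
`Wd = [1,1,0,−37669921933650,−581314396059525847500]` by §1. CONDITIONAL on the readings `hN`, `hordL` only; fact-free.
[cite: GrossLMS1991, §1 (p. 235)] [cite: Marcus2018, Ch. 2 Thm. 1] [cite: CremonaAlgorithms1997, Table 1 (class 384450d)] -/
theorem connectedOrderOneAnchor_of_isIsogenous_384450d1
    (W : WeierstrassCurve ℚ) [W.IsElliptic] [W.IsGloballyMinimal] (hW : W = ⟨1, 1, 0, -292284525, 12563872228125⟩)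
    (hN : W.conductorNorm ℤ = 384450)
    (Wd : WeierstrassCurve ℚ) [Wd.IsElliptic] [Wd.IsGloballyMinimal]
    (hWd : Wd = ⟨1, 1, 0, -37669921933650, -581314396059525847500⟩)
    (hordL : ∀ {M : ℕ} [NeZero M] (f : CuspForm (Gamma0 M) 2), IsNewformOf Wd f →
      ∀ (ϖ : ℚ), (ϖ : ℝ) * Wd.realPeriodRat = plusPeriod f →
      ∀ L : PowerSeries ℚ_[3], IsMultPAdicLFunctionOf f 3 (-1) L → L.order = ((1 : ℕ) : ℕ∞))
    (W' : WeierstrassCurve ℚ) [W'.IsElliptic] [W'.IsGloballyMinimal] (hiso : IsIsogenous W W') :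
    ∃ (W₁ : WeierstrassCurve ℚ) (_ : W₁.IsElliptic) (_ : W₁.IsGloballyMinimal)
      (W₀ : WeierstrassCurve ℚ) (_ : W₀.IsElliptic) (_ : W₀.IsGloballyMinimal),
      IsIsogenous W' W₁ ∧
      Relation.ReflTransGen (fun A B : WeierstrassCurve ℚ ↦ TwoStepAt 3 A B ∨
        (TwoStepAt 3 B A ∧ ∃ (_ : B.IsElliptic) (_ : B.IsGloballyMinimal), X2.CellB B 3)) W₁ W₀ ∧
      ¬ W₀.HasSplitMultiplicativeReductionAtPrime 3 ∧
      ∃ (K : Type) (_ : Field K) (_ : NumberField K), IsImaginaryQuadratic K ∧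
        SatisfiesHeegnerHypothesis (W₀.conductorNorm ℤ) K ∧ SatisfiesHeegnerHypothesis 3 K ∧
        Odd (NumberField.discr K) ∧ NumberField.discr K < -4 ∧
        ∀ (Wd : WeierstrassCurve ℚ) [Wd.IsElliptic] [Wd.IsGloballyMinimal],
          (∃ C : VariableChange ℚ, C • Wd = W₀.quadraticTwist (NumberField.discr K : ℚ)) →
          ∀ {M : ℕ} [NeZero M] (f : CuspForm (Gamma0 M) 2), IsNewformOf Wd f →
          ∀ (ϖ : ℚ), (ϖ : ℝ) * Wd.realPeriodRat = plusPeriod f →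
          ∀ L : PowerSeries ℚ_[3], IsMultPAdicLFunctionOf f 3 (-1) L → L.order = ((1 : ℕ) : ℕ∞) := by
  subst hW hWd
  haveI : Fact ((-359 : ℤ) < 0) := ⟨by norm_num⟩
  obtain ⟨hK, hdK⟩ :=
    isImaginaryQuadratic_and_discr_sqrtField_of_squarefree_natAbs (-359) (by norm_num) (by decide +kernel)
  have h2 : Module.finrank ℚ (sqrtField (-359)) = 2 := sqrtField.finrank_eq_two _
  have hodd : Odd (NumberField.discr (sqrtField (-359))) := by rw [hdK]; exact ⟨-180, by norm_num⟩
  have hlt : NumberField.discr (sqrtField (-359)) < -4 := by rw [hdK]; norm_num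
  have hHN : SatisfiesHeegnerHypothesis
      ((⟨1, 1, 0, -292284525, 12563872228125⟩ : WeierstrassCurve ℚ).conductorNorm ℤ) (sqrtField (-359)) := by
    rw [hN]; exact satisfiesHeegnerHypothesis_N h2 hdK
  have hHp : SatisfiesHeegnerHypothesis 3 (sqrtField (-359)) :=
    DoubleTwistDisplayKit.satisfiesHeegnerHypothesis_three_of_discr (-359) (by norm_num) _ h2 hdK
  have hns : ¬ (⟨1, 1, 0, -292284525, 12563872228125⟩ : WeierstrassCurve ℚ).HasSplitMultiplicativeReductionAtPrime 3 :=
    nonsplit_384450d1.2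
  have hall := orderOne_forall_minimal_models_of_one (p := 3) (⟨1, 1, 0, -292284525, 12563872228125⟩ : WeierstrassCurve ℚ)
    _ exists_variableChange_twist hordL
  refine ⟨_, inferInstance, inferInstance, _, inferInstance, inferInstance, hiso.symm_of_charZero,
    Relation.ReflTransGen.refl, hns, sqrtField (-359), inferInstance, inferInstance, hK, hHN, hHp, hodd, hlt, ?_⟩
  rw [hdK]
  exact hall

/-- **The REGISTERED stub 6⁷'s RIGHT disjunct («connected partnered vertex», VERBATIM at `p = 3`) at EVERY globally minimal
`W' ∼ 384450d1`** — LEAD g15's p679233 §2 `connectedPartner_of_connectedOrderOneAnchor` on the anchor datum above: the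
order-one certificate gives `r_an(E₀^{(d_K)}) = 1` and the upper half at every minimal model of the twist by x2-p1-w3 g11's
p661229 §1 (Perrin-Riou, Disegni Thm. 2.4, Hoffstein–Luo, Gross–Zagier; Disegni Thm. 4(1) under Greenberg–Vatsal). Named facts
BY NAME: `PublishedInputs` (item 19037), Disegni 2020 Thm. 4(1) `padicBSD_rankOne_nonsplitMult`, Disegni 2020 Thm. 2.4
`padicGrossZagier_nonsplitMult` — PUBLISHED; readings `hr`, `hN`, `hordL`. CONDITIONAL; nothing booked.
[cite: Disegni2020, §2.2 Thm. 2.4 and §3.2 Thm. 4] [cite: PerrinRiou1987, §1.4 Cor. 1.8] [cite: GreenbergVatsal2000, Thm. (1.3)] -/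
theorem connectedPartner_of_isIsogenous_384450d1 (hP : EisensteinPrimes.PublishedInputs)
    (hDis : padicBSD_rankOne_nonsplitMult) (hDGZ : padicGrossZagier_nonsplitMult)
    (W : WeierstrassCurve ℚ) [W.IsElliptic] [W.IsGloballyMinimal] (hW : W = ⟨1, 1, 0, -292284525, 12563872228125⟩)
    (hr : W.analyticRank = 0) (hN : W.conductorNorm ℤ = 384450)
    (Wd : WeierstrassCurve ℚ) [Wd.IsElliptic] [Wd.IsGloballyMinimal]
    (hWd : Wd = ⟨1, 1, 0, -37669921933650, -581314396059525847500⟩)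
    (hordL : ∀ {M : ℕ} [NeZero M] (f : CuspForm (Gamma0 M) 2), IsNewformOf Wd f →
      ∀ (ϖ : ℚ), (ϖ : ℝ) * Wd.realPeriodRat = plusPeriod f →
      ∀ L : PowerSeries ℚ_[3], IsMultPAdicLFunctionOf f 3 (-1) L → L.order = ((1 : ℕ) : ℕ∞))
    (W' : WeierstrassCurve ℚ) [W'.IsElliptic] [W'.IsGloballyMinimal] (hiso : IsIsogenous W W') :
    ∃ (W₁ : WeierstrassCurve ℚ) (_ : W₁.IsElliptic) (_ : W₁.IsGloballyMinimal)
      (U : WeierstrassCurve ℚ) (_ : U.IsElliptic) (_ : U.IsGloballyMinimal)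
      (W₀ : WeierstrassCurve ℚ) (_ : W₀.IsElliptic) (_ : W₀.IsGloballyMinimal),
      IsIsogenous W' W₁ ∧
      Relation.ReflTransGen (fun A B : WeierstrassCurve ℚ ↦ TwoStepAt 3 A B ∨
        (TwoStepAt 3 B A ∧ ∃ (_ : B.IsElliptic) (_ : B.IsGloballyMinimal), X2.CellB B 3)) W₁ U ∧
      IsIsogenous U W₀ ∧
      ∃ (K : Type) (_ : Field K) (_ : NumberField K), IsImaginaryQuadratic K ∧
        SatisfiesHeegnerHypothesis (W₀.conductorNorm ℤ) K ∧ SatisfiesHeegnerHypothesis 3 K ∧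
        Odd (NumberField.discr K) ∧ NumberField.discr K < -4 ∧
        (W₀.quadraticTwist (NumberField.discr K : ℚ)).analyticRank = 1 ∧
        ∀ (Wd : WeierstrassCurve ℚ) [Wd.IsElliptic] [Wd.IsGloballyMinimal],
          (∃ C : VariableChange ℚ, C • Wd = W₀.quadraticTwist (NumberField.discr K : ℚ)) →
          MissingUpperBoundAt Wd 3 := by
  have hA := connectedOrderOneAnchor_of_isIsogenous_384450d1 W hW hN Wd hWd hordL W' hiso
  subst hW
  have hc : X2.CellB (⟨1, 1, 0, -292284525, 12563872228125⟩ : WeierstrassCurve ℚ) 3 := cellB_384450d1_of_analyticRank hr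
  have hc' : X2.CellB W' 3 := (EisensteinPrimesMazurMCOnCellBTwistbackIsogenyTransport.cellB_iff_of_isIsogenous hiso).mp hc
  exact EisensteinPrimesMazurMCOnCellBTwistbackConnectedPartnerZigzag.connectedPartner_of_connectedOrderOneAnchor hP hDis hDGZ
    hA hc'

/-- **Both Cremona members of class `384450d` carry 6⁷'s RIGHT disjunct at `p = 3`** (binder `hW' : W' = d1 ∨ W' = d2`):
`connectedPartner_of_isIsogenous_384450d1` with the identity isogeny resp. x2-p1-w7 g3's kernel certificate
`isIsogenous_384450d1_384450d2` (Vélu, `…A10IsogenyCertificates08`). CONDITIONAL on the three PUB facts and the readings;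
nothing booked. [cite: Velu1971] [cite: CremonaAlgorithms1997, §3.8 and Table 1 (class 384450d)] -/
theorem connectedPartner_384450d_members (hP : EisensteinPrimes.PublishedInputs)
    (hDis : padicBSD_rankOne_nonsplitMult) (hDGZ : padicGrossZagier_nonsplitMult)
    (W : WeierstrassCurve ℚ) [W.IsElliptic] [W.IsGloballyMinimal] (hW : W = ⟨1, 1, 0, -292284525, 12563872228125⟩)
    (hr : W.analyticRank = 0) (hN : W.conductorNorm ℤ = 384450)
    (Wd : WeierstrassCurve ℚ) [Wd.IsElliptic] [Wd.IsGloballyMinimal]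
    (hWd : Wd = ⟨1, 1, 0, -37669921933650, -581314396059525847500⟩)
    (hordL : ∀ {M : ℕ} [NeZero M] (f : CuspForm (Gamma0 M) 2), IsNewformOf Wd f →
      ∀ (ϖ : ℚ), (ϖ : ℝ) * Wd.realPeriodRat = plusPeriod f →
      ∀ L : PowerSeries ℚ_[3], IsMultPAdicLFunctionOf f 3 (-1) L → L.order = ((1 : ℕ) : ℕ∞))
    (W' : WeierstrassCurve ℚ) [W'.IsElliptic] [W'.IsGloballyMinimal]
    (hW' : W' = ⟨1, 1, 0, -292284525, 12563872228125⟩ ∨ W' = ⟨1, 1, 0, 2620799475, -332237331799875⟩) :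
    ∃ (W₁ : WeierstrassCurve ℚ) (_ : W₁.IsElliptic) (_ : W₁.IsGloballyMinimal)
      (U : WeierstrassCurve ℚ) (_ : U.IsElliptic) (_ : U.IsGloballyMinimal)
      (W₀ : WeierstrassCurve ℚ) (_ : W₀.IsElliptic) (_ : W₀.IsGloballyMinimal),
      IsIsogenous W' W₁ ∧
      Relation.ReflTransGen (fun A B : WeierstrassCurve ℚ ↦ TwoStepAt 3 A B ∨
        (TwoStepAt 3 B A ∧ ∃ (_ : B.IsElliptic) (_ : B.IsGloballyMinimal), X2.CellB B 3)) W₁ U ∧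
      IsIsogenous U W₀ ∧
      ∃ (K : Type) (_ : Field K) (_ : NumberField K), IsImaginaryQuadratic K ∧
        SatisfiesHeegnerHypothesis (W₀.conductorNorm ℤ) K ∧ SatisfiesHeegnerHypothesis 3 K ∧
        Odd (NumberField.discr K) ∧ NumberField.discr K < -4 ∧
        (W₀.quadraticTwist (NumberField.discr K : ℚ)).analyticRank = 1 ∧
        ∀ (Wd : WeierstrassCurve ℚ) [Wd.IsElliptic] [Wd.IsGloballyMinimal],
          (∃ C : VariableChange ℚ, C • Wd = W₀.quadraticTwist (NumberField.discr K : ℚ)) →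
          MissingUpperBoundAt Wd 3 := by
  have h := connectedPartner_of_isIsogenous_384450d1 hP hDis hDGZ W hW hr hN Wd hWd hordL
  subst hW
  rcases hW' with rfl | rfl
  · exact h _ (WeierstrassCurve.isIsogenous_self _)
  · exact h _ isIsogenous_384450d1_384450d2

/-! ## §3 Mazur's main conjecture and `BSD(E,3)` at both members — the v12 cone BY NAME + THREE readings -/

/-- **Mazur's main conjecture at EVERY globally minimal curve `ℚ`-isogenous to `384450d1`, at `p = 3`** — LEAD g15's p675388 §2
`mazurMainConjectureAt_of_cellB_of_connectedOrderOneAnchor` on the anchor datum of §2 (X2b moved to `W'` by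
`…IsogenyTransport.cellB_iff_of_isIsogenous`). Named facts BY NAME: `PublishedInputs` (item 19037); Disegni 2020 Thm. 4(1), Thm.
2.4, Hsieh 2014 Thm. 1, Liu–Zhang–Zhang 2018, Mazur 1978 Cor. 4.1 — PUBLISHED; Keller–Yin Thm. D — PREPRINT; Poitou–Tate ×2
discharged by the tree's `poitouTate_selmerStructure_duality_holds` / `poitouTate_sha_tateDual_holds`. Readings `hr`, `hN`, `hordL`.
CONDITIONAL; a main conjecture is proved unconditionally for no curve. [claim: KellerYin2024, status: under-review]
[cite: KellerYin2024, Thm. D = Thm. 5.1.3 (arXiv:2402.12781v2 L306–L309)] [cite: Disegni2020, §2.2 Thm. 2.4 and §3.2 Thm. 4]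
[cite: Wuthrich2014, Thm. 16 (p. 397)] [cite: Hsieh2014, Thm. 1] [cite: LiuZhangZhang2018, Thms. 1.5.1 and 1.5.3]
[cite: Mazur1978, Cor. 4.1] [cite: MilneADT2006, Thm. I.7.3] -/
theorem mazurMainConjectureAt_of_isIsogenous_384450d1 (hP : EisensteinPrimes.PublishedInputs)
    (hH : hsieh2014_exists_anticyclotomicPAdicLFunction)
    (hF : LiuZhangZhang2018.thm151_thm153_modularCurve_heegnerVector) (hMaz : mazur_not_dvd_maninConstant_of_odd)
    (hDis : padicBSD_rankOne_nonsplitMult) (hDGZ : padicGrossZagier_nonsplitMult)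
    (hD : KellerYin2024.thmD_imcMult_exists_isBDPLFunction_isTorsion_charIdeal_eq_OPEN)
    (W : WeierstrassCurve ℚ) [W.IsElliptic] [W.IsGloballyMinimal] (hW : W = ⟨1, 1, 0, -292284525, 12563872228125⟩)
    (hr : W.analyticRank = 0) (hN : W.conductorNorm ℤ = 384450)
    (Wd : WeierstrassCurve ℚ) [Wd.IsElliptic] [Wd.IsGloballyMinimal]
    (hWd : Wd = ⟨1, 1, 0, -37669921933650, -581314396059525847500⟩)
    (hordL : ∀ {M : ℕ} [NeZero M] (f : CuspForm (Gamma0 M) 2), IsNewformOf Wd f →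
      ∀ (ϖ : ℚ), (ϖ : ℝ) * Wd.realPeriodRat = plusPeriod f →
      ∀ L : PowerSeries ℚ_[3], IsMultPAdicLFunctionOf f 3 (-1) L → L.order = ((1 : ℕ) : ℕ∞))
    (W' : WeierstrassCurve ℚ) [W'.IsElliptic] [W'.IsGloballyMinimal] (hiso : IsIsogenous W W') :
    X2.MazurMainConjectureAt W' 3 := by
  have hA := connectedOrderOneAnchor_of_isIsogenous_384450d1 W hW hN Wd hWd hordL W' hiso
  subst hW
  have hc : X2.CellB (⟨1, 1, 0, -292284525, 12563872228125⟩ : WeierstrassCurve ℚ) 3 := cellB_384450d1_of_analyticRank hr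
  have hc' : X2.CellB W' 3 := (EisensteinPrimesMazurMCOnCellBTwistbackIsogenyTransport.cellB_iff_of_isIsogenous hiso).mp hc
  exact EisensteinPrimesMazurMCOnCellBTwistbackOrderOneAnchorZigzag.mazurMainConjectureAt_of_cellB_of_connectedOrderOneAnchor hP
    (fun L _ _ ↦ SchneiderFreeAdditiveX3.PoitouTateReduction.poitouTate_selmerStructure_duality_holds L)
    (fun L _ _ ↦ SchneiderFreeAdditiveX3.PoitouTateReduction.poitouTate_sha_tateDual_holds L) hH hF hMaz hDis hDGZ hD W' 3
    hc' hA

/-- **`BSD(E, 3)` at EVERY globally minimal curve `ℚ`-isogenous to `384450d1`** — p675388 §2 `bsdp_of_cellB_of_connectedOrderOneAnchor`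
on the anchor datum of §2; same named facts and readings. CONDITIONAL; nothing booked. [claim: KellerYin2024, status: under-review]
[cite: KellerYin2024, Thm. D = Thm. 5.1.3] [cite: Disegni2020, §2.2 Thm. 2.4 and §3.2 Thm. 4] [cite: MilneADT2006, Thm. I.7.3]
[cite: Miller2011LMS, Def. 1.1] -/
theorem bsdp_of_isIsogenous_384450d1 (hP : EisensteinPrimes.PublishedInputs)
    (hH : hsieh2014_exists_anticyclotomicPAdicLFunction)
    (hF : LiuZhangZhang2018.thm151_thm153_modularCurve_heegnerVector) (hMaz : mazur_not_dvd_maninConstant_of_odd)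
    (hDis : padicBSD_rankOne_nonsplitMult) (hDGZ : padicGrossZagier_nonsplitMult)
    (hD : KellerYin2024.thmD_imcMult_exists_isBDPLFunction_isTorsion_charIdeal_eq_OPEN)
    (W : WeierstrassCurve ℚ) [W.IsElliptic] [W.IsGloballyMinimal] (hW : W = ⟨1, 1, 0, -292284525, 12563872228125⟩)
    (hr : W.analyticRank = 0) (hN : W.conductorNorm ℤ = 384450)
    (Wd : WeierstrassCurve ℚ) [Wd.IsElliptic] [Wd.IsGloballyMinimal]
    (hWd : Wd = ⟨1, 1, 0, -37669921933650, -581314396059525847500⟩)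
    (hordL : ∀ {M : ℕ} [NeZero M] (f : CuspForm (Gamma0 M) 2), IsNewformOf Wd f →
      ∀ (ϖ : ℚ), (ϖ : ℝ) * Wd.realPeriodRat = plusPeriod f →
      ∀ L : PowerSeries ℚ_[3], IsMultPAdicLFunctionOf f 3 (-1) L → L.order = ((1 : ℕ) : ℕ∞))
    (W' : WeierstrassCurve ℚ) [W'.IsElliptic] [W'.IsGloballyMinimal] (hiso : IsIsogenous W W') :
    BSDp W' 3 := by
  have hA := connectedOrderOneAnchor_of_isIsogenous_384450d1 W hW hN Wd hWd hordL W' hiso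
  subst hW
  have hc : X2.CellB (⟨1, 1, 0, -292284525, 12563872228125⟩ : WeierstrassCurve ℚ) 3 := cellB_384450d1_of_analyticRank hr
  have hc' : X2.CellB W' 3 := (EisensteinPrimesMazurMCOnCellBTwistbackIsogenyTransport.cellB_iff_of_isIsogenous hiso).mp hc
  exact EisensteinPrimesMazurMCOnCellBTwistbackOrderOneAnchorZigzag.bsdp_of_cellB_of_connectedOrderOneAnchor hP
    (fun L _ _ ↦ SchneiderFreeAdditiveX3.PoitouTateReduction.poitouTate_selmerStructure_duality_holds L)
    (fun L _ _ ↦ SchneiderFreeAdditiveX3.PoitouTateReduction.poitouTate_sha_tateDual_holds L) hH hF hMaz hDis hDGZ hD W' 3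
    hc' hA

/-- **Mazur's main conjecture at both Cremona members of class `384450d`, at `p = 3`** (binder `hW' : W' = d1 ∨ W' = d2`;
identity isogeny resp. `isIsogenous_384450d1_384450d2`). CONDITIONAL on the named facts and the three readings; nothing booked.
[claim: KellerYin2024, status: under-review] [cite: KellerYin2024, Thm. D = Thm. 5.1.3] [cite: Velu1971]
[cite: CremonaAlgorithms1997, Table 1 (class 384450d)] -/
theorem mazurMainConjectureAt_384450d_members_at_three (hP : EisensteinPrimes.PublishedInputs)
    (hH : hsieh2014_exists_anticyclotomicPAdicLFunction)
    (hF : LiuZhangZhang2018.thm151_thm153_modularCurve_heegnerVector) (hMaz : mazur_not_dvd_maninConstant_of_odd)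
    (hDis : padicBSD_rankOne_nonsplitMult) (hDGZ : padicGrossZagier_nonsplitMult)
    (hD : KellerYin2024.thmD_imcMult_exists_isBDPLFunction_isTorsion_charIdeal_eq_OPEN)
    (W : WeierstrassCurve ℚ) [W.IsElliptic] [W.IsGloballyMinimal] (hW : W = ⟨1, 1, 0, -292284525, 12563872228125⟩)
    (hr : W.analyticRank = 0) (hN : W.conductorNorm ℤ = 384450)
    (Wd : WeierstrassCurve ℚ) [Wd.IsElliptic] [Wd.IsGloballyMinimal]
    (hWd : Wd = ⟨1, 1, 0, -37669921933650, -581314396059525847500⟩)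
    (hordL : ∀ {M : ℕ} [NeZero M] (f : CuspForm (Gamma0 M) 2), IsNewformOf Wd f →
      ∀ (ϖ : ℚ), (ϖ : ℝ) * Wd.realPeriodRat = plusPeriod f →
      ∀ L : PowerSeries ℚ_[3], IsMultPAdicLFunctionOf f 3 (-1) L → L.order = ((1 : ℕ) : ℕ∞))
    (W' : WeierstrassCurve ℚ) [W'.IsElliptic] [W'.IsGloballyMinimal]
    (hW' : W' = ⟨1, 1, 0, -292284525, 12563872228125⟩ ∨ W' = ⟨1, 1, 0, 2620799475, -332237331799875⟩) :
    X2.MazurMainConjectureAt W' 3 := by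
  have h := mazurMainConjectureAt_of_isIsogenous_384450d1 hP hH hF hMaz hDis hDGZ hD W hW hr hN Wd hWd hordL
  subst hW
  rcases hW' with rfl | rfl
  · exact h _ (WeierstrassCurve.isIsogenous_self _)
  · exact h _ isIsogenous_384450d1_384450d2

/-- **`BSD(E, 3)` at both Cremona members of class `384450d`** — as the main-conjecture head. CONDITIONAL on the named facts
and the three readings; nothing booked. [claim: KellerYin2024, status: under-review] [cite: KellerYin2024, Thm. D = Thm. 5.1.3]
[cite: MilneADT2006, Thm. I.7.3 (Cassels)] [cite: Velu1971] -/
theorem bsdp_384450d_members_at_three (hP : EisensteinPrimes.PublishedInputs)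
    (hH : hsieh2014_exists_anticyclotomicPAdicLFunction)
    (hF : LiuZhangZhang2018.thm151_thm153_modularCurve_heegnerVector) (hMaz : mazur_not_dvd_maninConstant_of_odd)
    (hDis : padicBSD_rankOne_nonsplitMult) (hDGZ : padicGrossZagier_nonsplitMult)
    (hD : KellerYin2024.thmD_imcMult_exists_isBDPLFunction_isTorsion_charIdeal_eq_OPEN)
    (W : WeierstrassCurve ℚ) [W.IsElliptic] [W.IsGloballyMinimal] (hW : W = ⟨1, 1, 0, -292284525, 12563872228125⟩)
    (hr : W.analyticRank = 0) (hN : W.conductorNorm ℤ = 384450)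
    (Wd : WeierstrassCurve ℚ) [Wd.IsElliptic] [Wd.IsGloballyMinimal]
    (hWd : Wd = ⟨1, 1, 0, -37669921933650, -581314396059525847500⟩)
    (hordL : ∀ {M : ℕ} [NeZero M] (f : CuspForm (Gamma0 M) 2), IsNewformOf Wd f →
      ∀ (ϖ : ℚ), (ϖ : ℝ) * Wd.realPeriodRat = plusPeriod f →
      ∀ L : PowerSeries ℚ_[3], IsMultPAdicLFunctionOf f 3 (-1) L → L.order = ((1 : ℕ) : ℕ∞))
    (W' : WeierstrassCurve ℚ) [W'.IsElliptic] [W'.IsGloballyMinimal]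
    (hW' : W' = ⟨1, 1, 0, -292284525, 12563872228125⟩ ∨ W' = ⟨1, 1, 0, 2620799475, -332237331799875⟩) :
    BSDp W' 3 := by
  have h := bsdp_of_isIsogenous_384450d1 hP hH hF hMaz hDis hDGZ hD W hW hr hN Wd hWd hordL
  subst hW
  rcases hW' with rfl | rfl
  · exact h _ (WeierstrassCurve.isIsogenous_self _)
  · exact h _ isIsogenous_384450d1_384450d2

end Summit.BirchSwinnertonDyer.BirchSwinnertonDyer.Theorems.EisensteinPrimesMazurMCOnCellBTwistbackAnchoredCell384450d

end
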